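import Literature.NumberTheory.GaloisRepresentations.GlobalArtinMapNormProofs
import Literature.NumberTheory.GaloisRepresentations.AlgebraicHeckeCharacterGrossencharakterProofs
import Literature.NumberTheory.GaloisRepresentations.HeckeCharacterAutConj
import Literature.NumberTheory.AdelicBaseChange.AdeleNormGalois
import Literature.NumberTheory.AdelicBaseChange.AdeleNormArchimedean
import Literature.NumberTheory.AdelicBaseChange.IdeleNormModule
import Literature.NumberTheory.GaloisRepresentations.HeckeCharacterNormCharacter
import HarnessLib

/-!
# The infinity type of `χ ∘ N_{E/F}` over a totally complex base (Weil 1956 §1: restriction of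
# the type along the embeddings; Cassels–Fröhlich II §19 (19.19) at the archimedean places)

Topic `NumberTheory/GaloisRepresentations`; namespace
`Literature.NumberTheory.GaloisRepresentations`. PROOFS ONLY (no definition, no named fact, no
`sorry`). Requested by route `BiquadraticEisensteinDescent` of `Summits/BirchSwinnertonDyer` (crux
`EisensteinHeartFlatCMInertBadKPrime`, hypothesis (T) of `…KatzHsiehDisplay` / `…KatzHsiehSocket`:
the Katz type of `λ · χ∘N_{L/K′}` on the biquadratic CM field `L = K_CM·K′`, BOTH factors being
base changes from an IMAGINARY QUADRATIC field) as steps (ii)–(iv) of the plan recorded in that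
crux's V2 memo (step (i) = `ArchFactorEmbeddingIndexedProofs`); also the shape of the `HasKatzType`
binder of the anticyclotomic non-vanishing facts `Hsieh2012.*` / `HeWei2025.*` at that data.

For number fields `F ⊆ E` with `E/F` Galois and a Hecke character `χ` of `F` the tree's base change
`χ.compRelNorm E = χ ∘ N_{E/F}` (`GlobalArtinMapNormProofs`, through the Galois-descent norm
`Automorphic.AdeleRing.ideleRelNorm`, identified with Cassels's determinant norm by
`AdelicBaseChange.automorphic_ideleRelNorm_eq`). We prove:

* §1 `extensionEmbedding_algebraNorm_completion_of_comp_eq` / `…_of_conjugate_comp_eq` — at a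
  COMPLEX place `v` of `F` and a place `w ∣ v` of `E` (`E_w = F_v = ℂ`), the local norm
  `N_{E_w/F_v}` is the identification `E_w = F_v`, read through the embeddings:
  `ι_v(N_{E_w/F_v} z) = ι_w(z)` if `σ_w|_F = σ_v` and `= \overline{ι_w(z)}` if `σ̄_w|_F = σ_v`
  (`σ_w = w.embedding`, `ι_w = extensionEmbedding w`; Mathlib `Algebra.norm_eq_of_equiv_equiv`,
  exactly as in `AdelicBaseChange.IdeleNormModule.norm_algebraNorm_completion_eq_pow`).
* §2 `ideleRelNorm_infiniteIdeles`, `compRelNorm_infiniteIdeles` — the norm of an infinite idele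
  `(y, 1)` is the infinite idele `(N_∞ y, 1)`, `N_∞ = AdelicBaseChange.infiniteAdeleRelNorm`
  (Cassels (19.15)–(19.17): `fst_adeleRelNorm`, `snd_adeleRelNorm`), so
  `(χ ∘ N)((y, 1)) = χ((N_∞ y, 1))`.
* §3 **`HeckeCharacter.HasInfinityType.compRelNorm`** — for `F` TOTALLY COMPLEX: if `χ` has
  infinity type `(p, q)` (`χ((x,1)) = ∏_v ι_v(x_v)^{-p_v} \overline{ι_v(x_v)}^{-q_v}` near `1`), then
  `χ ∘ N_{E/F}` has infinity type `(p′, q′)` with `(p′_w, q′_w) = (p_v, q_v)` if `σ_w|_F = σ_v` and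
  `(q_v, p_v)` otherwise, `v = w|_F` ((19.19): `(N_∞ y)_v = ∏_{w∣v} N_{E_w/F_v}(y_w)`,
  `AdelicBaseChange.infiniteAdeleRelNorm_apply_eq_prod`, then §1 place by place and regrouping
  `∏_v ∏_{w∣v} = ∏_w`). In exponent-function language this is Weil's "the type of `χ ∘ N_{E/F}`
  is `n ∘ (φ ↦ φ|_F)`"; the real-place case (`[E_w : F_v] = 2`, `N z = z z̄`, type
  `(p_v + q_v, p_v + q_v)`) is not needed by the consumers and not typed.

References: [Weil1956] A. Weil, *On a certain type of characters of the idèle-class group of an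
algebraic number-field* (1956), §1 (types `(A₀)` and their behaviour under `N_{k′/k}`);
[CasselsFrohlichANT1967] J. W. S. Cassels, *Global fields*, Ch. II §11 (archimedean norms), §19
(19.15)–(19.19); [SerreAbelianLadic1968] Ch. II §2.4.
-/

noncomputable section

open scoped NumberField Topology ComplexConjugate Classical NumberField.LiesOver
open NumberField IsDedekindDomain Filter NumberField.InfinitePlace NumberField.InfinitePlace.Completion
open NumberField.ComplexEmbedding

namespace Literature.NumberTheory.GaloisRepresentations

open Literature.NumberTheory.AdelicBaseChange (infiniteAdeleRelNorm)

/-! ### §1. The local norm at a complex place, through the embeddings -/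

section LocalNorm

variable {F E : Type*} [Field F] [Field E] [Algebra F E]

/-- **`ι_v(N_{E_w/F_v} z) = ι_w(z)`** at a complex place `v` of `F` and `w ∣ v` whose chosen
embedding restricts to that of `v` (`E_w = F_v = ℂ`, the norm is the identification).
[cite: CasselsFrohlichANT1967, Ch. II §11 (archimedean case `ℂ/ℂ`)] -/
theorem extensionEmbedding_algebraNorm_completion_of_comp_eq {v : InfinitePlace F}
    (hv : v.IsComplex) (w : InfinitePlace E) [w.1.LiesOver v.1]
    (hl : w.embedding.comp (algebraMap F E) = v.embedding) (z : w.Completion) :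
    extensionEmbedding v (Algebra.norm v.Completion z) = extensionEmbedding w z := by
  have hw : w.IsComplex := LiesOver.isComplex_of_isComplex_under w hv
  haveI : ComplexEmbedding.LiesOver w.embedding v.embedding := ⟨hl⟩
  haveI := liesOver_extensionEmbedding w v
  have he : (algebraMap ℂ ℂ).comp (ringEquivComplexOfIsComplex hv : v.Completion →+* ℂ) =
      (ringEquivComplexOfIsComplex hw : w.Completion →+* ℂ).comp
        (algebraMap v.Completion w.Completion) := by
    ext; simp
  have key := Algebra.norm_eq_of_equiv_equiv (ringEquivComplexOfIsComplex hv)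
    (ringEquivComplexOfIsComplex hw) he z
  rw [Algebra.norm_self, MonoidHom.id_apply] at key
  rw [key]
  exact (ringEquivComplexOfIsComplex hv).apply_symm_apply _

/-- **`ι_v(N_{E_w/F_v} z) = \overline{ι_w(z)}`** at a complex place `v` of `F` and `w ∣ v` whose
CONJUGATE embedding restricts to that of `v`.
[cite: CasselsFrohlichANT1967, Ch. II §11 (archimedean case `ℂ/ℂ`)] -/
theorem extensionEmbedding_algebraNorm_completion_of_conjugate_comp_eq {v : InfinitePlace F}
    (hv : v.IsComplex) (w : InfinitePlace E) [w.1.LiesOver v.1]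
    (hr : (conjugate w.embedding).comp (algebraMap F E) = v.embedding) (z : w.Completion) :
    extensionEmbedding v (Algebra.norm v.Completion z) = conj (extensionEmbedding w z) := by
  have hw : w.IsComplex := LiesOver.isComplex_of_isComplex_under w hv
  haveI : ComplexEmbedding.LiesOver (conjugate w.embedding) v.embedding := ⟨hr⟩
  haveI := liesOver_conjugate_extensionEmbedding w v
  have he : (algebraMap ℂ ℂ).comp (ringEquivComplexOfIsComplex hv : v.Completion →+* ℂ) =
      (((ringEquivComplexOfIsComplex hw).trans (starRingAut (R := ℂ))) : w.Completion →+* ℂ).comp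
        (algebraMap v.Completion w.Completion) := by
    ext; simp [← conjugate_coe_eq]
  have key := Algebra.norm_eq_of_equiv_equiv (ringEquivComplexOfIsComplex hv)
    ((ringEquivComplexOfIsComplex hw).trans (starRingAut (R := ℂ))) he z
  rw [Algebra.norm_self, MonoidHom.id_apply] at key
  rw [key]
  change ringEquivComplexOfIsComplex hv ((ringEquivComplexOfIsComplex hv).symm _) = _
  rw [RingEquiv.apply_symm_apply]
  rfl

/-- The two cases together: `ι_v(N_{E_w/F_v} z)` is `ι_w(z)` or `\overline{ι_w(z)}` according to
whether `σ_w|_F = σ_v` (at a complex `v`; one of `σ_w`, `σ̄_w` restricts to `σ_v`, Mathlib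
`LiesOver.embedding_comp_eq_or_conjugate_embedding_comp_eq`).
[cite: CasselsFrohlichANT1967, Ch. II §11 (archimedean case `ℂ/ℂ`)] -/
theorem extensionEmbedding_algebraNorm_completion_eq_ite {v : InfinitePlace F}
    (hv : v.IsComplex) (w : InfinitePlace E) [w.1.LiesOver v.1] (z : w.Completion) :
    extensionEmbedding v (Algebra.norm v.Completion z) =
      if w.embedding.comp (algebraMap F E) = v.embedding then extensionEmbedding w z
      else conj (extensionEmbedding w z) := by
  split_ifs with h
  · exact extensionEmbedding_algebraNorm_completion_of_comp_eq hv w h z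
  · exact extensionEmbedding_algebraNorm_completion_of_conjugate_comp_eq hv w
      ((LiesOver.embedding_comp_eq_or_conjugate_embedding_comp_eq w v).resolve_left h) z

end LocalNorm

/-! ### §2. The norm of an infinite idele -/

section InfiniteIdeles

variable (F E : Type) [Field F] [Field E] [Algebra F E] [NumberField F] [NumberField E]

/-- **`N_{E/F}((y, 1)) = (N_∞ y, 1)`**: Cassels's determinant norm of an infinite idele is the
infinite idele of the norm of its archimedean part ((19.15)–(19.17), `fst_adeleRelNorm`,
`snd_adeleRelNorm`). [cite: CasselsFrohlichANT1967, Ch. II §19 (19.15)–(19.17)] -/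
theorem ideleRelNorm_infiniteIdeles (y : (InfiniteAdeleRing E)ˣ) :
    AdelicBaseChange.ideleRelNorm F E (infiniteIdeles E y) =
      infiniteIdeles F (Units.map (infiniteAdeleRelNorm F E) y) := by
  refine Units.ext (Prod.ext ?_ ?_)
  · rw [AdelicBaseChange.coe_ideleRelNorm, AdelicBaseChange.fst_adeleRelNorm, infiniteIdeles_fst,
      infiniteIdeles_fst, Units.coe_map]
  · rw [AdelicBaseChange.coe_ideleRelNorm, AdelicBaseChange.snd_adeleRelNorm]
    have h1 : ((infiniteIdeles E y : ideleGroup E) : AdeleRing (𝓞 E) E).2 = 1 := rfl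
    have h2 : ((infiniteIdeles F (Units.map (infiniteAdeleRelNorm F E) y) : ideleGroup F) :
        AdeleRing (𝓞 F) F).2 = 1 := rfl
    rw [h1, h2, map_one]

variable [IsGalois F E]

/-- The same for the Galois-descent norm `Automorphic.AdeleRing.ideleRelNorm` (the two norms agree,
`AdelicBaseChange.automorphic_ideleRelNorm_eq`). [cite: CasselsFrohlichANT1967, Ch. VII §7.3 (a)] -/
theorem automorphic_ideleRelNorm_infiniteIdeles (y : (InfiniteAdeleRing E)ˣ) :
    Automorphic.AdeleRing.ideleRelNorm F E (infiniteIdeles E y) =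
      infiniteIdeles F (Units.map (infiniteAdeleRelNorm F E) y) := by
  rw [AdelicBaseChange.automorphic_ideleRelNorm_eq, ideleRelNorm_infiniteIdeles]

/-- **`(χ ∘ N_{E/F})((y, 1)) = χ((N_∞ y, 1))`** for the tree's base change `χ.compRelNorm E`.
[cite: CasselsFrohlichANT1967, Ch. VII Prop. 4.3 (`ψ ∘ N`), Ch. II §19 (19.17)] -/
theorem HeckeCharacter.compRelNorm_infiniteIdeles (χ : HeckeCharacter F) (y : (InfiniteAdeleRing E)ˣ) :
    χ.compRelNorm E (infiniteIdeles E y) = χ (infiniteIdeles F (Units.map (infiniteAdeleRelNorm F E) y)) := by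
  rw [HeckeCharacter.compRelNorm_apply, automorphic_ideleRelNorm_infiniteIdeles]

omit [IsGalois F E] in
/-- The archimedean norm on infinite ideles, `y ↦ N_∞ y`, is continuous (Cassels: «continuous
functions of 𝐀»). [cite: CasselsFrohlichANT1967, Ch. II §19 (19.7)] -/
theorem continuous_units_map_infiniteAdeleRelNorm :
    Continuous (Units.map (infiniteAdeleRelNorm F E) : (InfiniteAdeleRing E)ˣ → (InfiniteAdeleRing F)ˣ) :=
  Continuous.units_map _ (AdelicBaseChange.continuous_infiniteAdeleRelNorm F E)

end InfiniteIdeles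

/-! ### §3. The infinity type of `χ ∘ N_{E/F}` over a totally complex base -/

section InfinityType

variable {F : Type} (E : Type) [Field F] [Field E] [Algebra F E] [NumberField F] [NumberField E]
  [IsGalois F E] [IsTotallyComplex F]

omit [IsGalois F E] in
/-- **(19.19) through the embeddings, at a complex place**: for an infinite idele `y` of `E` and a
place `v` of the totally complex `F`,
`ι_v((N_∞ y)_v) = ∏_{w∣v} (ι_w(y_w) or \overline{ι_w(y_w)})` (orientation by `σ_w|_F = σ_v`).
[cite: CasselsFrohlichANT1967, Ch. II §19 (19.19)] -/
theorem extensionEmbedding_infiniteAdeleRelNorm_apply (y : InfiniteAdeleRing E) (v : InfinitePlace F) :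
    extensionEmbedding v (infiniteAdeleRelNorm F E y v) =
      ∏ w : v.Extension E,
        (if w.1.embedding.comp (algebraMap F E) = v.embedding then extensionEmbedding w.1 (y w.1)
          else conj (extensionEmbedding w.1 (y w.1))) := by
  rw [AdelicBaseChange.infiniteAdeleRelNorm_apply_eq_prod, map_prod]
  exact Finset.prod_congr rfl fun w _ ↦
    extensionEmbedding_algebraNorm_completion_eq_ite (IsTotallyComplex.isComplex v) w.1 (y w.1)

/-- **The infinity type of `χ ∘ N_{E/F}` (totally complex base).** If `χ` has infinity type
`(p, q)` then `χ.compRelNorm E = χ ∘ N_{E/F}` has infinity type `(p′, q′)` where, for a place `w` of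
`E` over `v = w|_F`, `(p′_w, q′_w) = (p_v, q_v)` if the chosen embedding of `w` restricts to that of
`v` and `(q_v, p_v)` if its conjugate does: near `1`,
`(χ∘N)((y,1)) = χ((N_∞ y, 1)) = ∏_v ι_v((N_∞y)_v)^{-p_v} \overline{ι_v((N_∞y)_v)}^{-q_v}` and
`ι_v((N_∞ y)_v) = ∏_{w∣v} ι_w(y_w)^{[±]}` by (19.19) and §1. Weil: the type of `χ ∘ N_{k′/k}` is the
pull-back of the type of `χ` along restriction of embeddings.
[cite: Weil1956, §1] [cite: CasselsFrohlichANT1967, Ch. II §19 (19.19)] -/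
theorem HeckeCharacter.HasInfinityType.compRelNorm {χ : HeckeCharacter F} {p q : InfinitePlace F → ℤ}
    (h : χ.HasInfinityType p q) :
    (χ.compRelNorm E).HasInfinityType
      (fun w ↦ if w.embedding.comp (algebraMap F E) = (w.comap (algebraMap F E)).embedding
        then p (w.comap (algebraMap F E)) else q (w.comap (algebraMap F E)))
      (fun w ↦ if w.embedding.comp (algebraMap F E) = (w.comap (algebraMap F E)).embedding
        then q (w.comap (algebraMap F E)) else p (w.comap (algebraMap F E))) := by
  obtain ⟨U, hU, hχ⟩ := h
  -- the neighbourhood: the preimage of `U` under the (continuous) archimedean norm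
  set N : (InfiniteAdeleRing E)ˣ →* (InfiniteAdeleRing F)ˣ := Units.map (infiniteAdeleRelNorm F E) with hN
  have hNc : Continuous N := continuous_units_map_infiniteAdeleRelNorm F E
  refine ⟨N ⁻¹' U, ?_, fun y hy ↦ ?_⟩
  · exact hNc.continuousAt.preimage_mem_nhds (by rwa [map_one])
  rw [HeckeCharacter.compRelNorm_infiniteIdeles, hχ _ hy, HeckeCharacter.archFactor_apply,
    HeckeCharacter.archFactor_apply]
  -- regroup the right-hand side along `w ↦ w|_F`
  rw [← Fintype.prod_fiberwise (fun w : InfinitePlace E ↦ w.comap (algebraMap F E))]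
  refine Finset.prod_congr rfl fun v _ ↦ ?_
  -- the `v`-factor: `ι_v((N y)_v) = ∏_{w ∣ v} (ι_w y_w)^{[±]}`
  have hval : ((N y : (InfiniteAdeleRing F)ˣ) : InfiniteAdeleRing F) v =
      infiniteAdeleRelNorm F E (y : InfiniteAdeleRing E) v := by
    rw [hN, Units.coe_map]
  rw [hval, extensionEmbedding_infiniteAdeleRelNorm_apply E (y : InfiniteAdeleRing E) v, map_prod,
    ← Finset.prod_zpow, ← Finset.prod_zpow, ← Finset.prod_mul_distrib]
  refine Finset.prod_congr rfl fun w _ ↦ ?_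
  have hwv : w.1.comap (algebraMap F E) = v := w.2
  rw [hwv]
  split_ifs with hor
  · rfl
  · rw [Complex.conj_conj, mul_comm]

/-- **Weil's form: the type of `χ ∘ N_{E/F}` is the exponent function `φ ↦ n(φ|_F)`.** If `χ` has
the type attached to an exponent function `n ∈ ℤ[Hom(F, ℂ)]` (`HeckeCharacter.typeOfExponent`:
`p_v = n(σ_v)`, `q_v = n(σ̄_v)`), then `χ.compRelNorm E` has the type attached to
`φ ↦ n(φ ∘ (F → E))` on `Hom(E, ℂ)` (`F` totally complex; then so is every place of `E`). This is
the form in which the Katz type `kΣ + κ(1 − c)` of a character of a CM field `K` transports to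
`K′ ⊇ K` with the INDUCED CM type `{φ : φ|_K ∈ Σ}` (`KatzCM.katzExponent`).
[cite: Weil1956, §1] [cite: SerreAbelianLadic1968, Ch. II §2.4] -/
theorem HeckeCharacter.HasInfinityType.compRelNorm_typeOfExponent {χ : HeckeCharacter F}
    (n : (F →+* ℂ) → ℤ)
    (h : χ.HasInfinityType (HeckeCharacter.typeOfExponent n).1 (HeckeCharacter.typeOfExponent n).2) :
    (χ.compRelNorm E).HasInfinityType
      (HeckeCharacter.typeOfExponent (fun φ : E →+* ℂ ↦ n (φ.comp (algebraMap F E)))).1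
      (HeckeCharacter.typeOfExponent (fun φ : E →+* ℂ ↦ n (φ.comp (algebraMap F E)))).2 := by
  have h' := h.compRelNorm E
  -- the two descriptions of the pulled-back type agree place by place
  have hnr : ∀ w : InfinitePlace E, ¬ w.IsReal := fun w hw ↦
    (not_isReal_iff_isComplex.mpr (IsTotallyComplex.isComplex (w.comap (algebraMap F E))))
      (hw.comap (algebraMap F E))
  have hvr : ∀ v : InfinitePlace F, ¬ v.IsReal := fun v ↦
    not_isReal_iff_isComplex.mpr (IsTotallyComplex.isComplex v)
  have hmk : ∀ w : InfinitePlace E,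
      w.comap (algebraMap F E) = InfinitePlace.mk (w.embedding.comp (algebraMap F E)) := fun w ↦ by
    rw [← comap_mk, mk_embedding]
  have hP : (HeckeCharacter.typeOfExponent (fun φ : E →+* ℂ ↦ n (φ.comp (algebraMap F E)))).1 =
      (fun w : InfinitePlace E ↦
        if w.embedding.comp (algebraMap F E) = (w.comap (algebraMap F E)).embedding
        then (HeckeCharacter.typeOfExponent n).1 (w.comap (algebraMap F E))
        else (HeckeCharacter.typeOfExponent n).2 (w.comap (algebraMap F E))) := by
    funext w
    simp only [HeckeCharacter.typeOfExponent]
    split_ifs with hor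
    · rw [hor]
    · exfalso; exact hvr _ ‹_›
    · -- `σ_w|_F ≠ σ_v`, hence `σ_w|_F = σ̄_v`
      rcases embedding_mk_eq (w.embedding.comp (algebraMap F E)) with h1 | h2
      · exact absurd (by rw [hmk w, h1]) hor
      · have hcc : conjugate (conjugate (w.embedding.comp (algebraMap F E))) =
            w.embedding.comp (algebraMap F E) := by
          ext x; simp
        rw [hmk w, h2, hcc]
  have hQ : (HeckeCharacter.typeOfExponent (fun φ : E →+* ℂ ↦ n (φ.comp (algebraMap F E)))).2 =
      (fun w : InfinitePlace E ↦
        if w.embedding.comp (algebraMap F E) = (w.comap (algebraMap F E)).embedding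
        then (HeckeCharacter.typeOfExponent n).2 (w.comap (algebraMap F E))
        else (HeckeCharacter.typeOfExponent n).1 (w.comap (algebraMap F E))) := by
    funext w
    simp only [HeckeCharacter.typeOfExponent, if_neg (hnr w)]
    split_ifs with hor
    · exfalso; exact hvr _ ‹_›
    · rw [ComplexEmbedding.conjugate_comp, hor]
    · rcases embedding_mk_eq (w.embedding.comp (algebraMap F E)) with h1 | h2
      · exact absurd (by rw [hmk w, h1]) hor
      · rw [ComplexEmbedding.conjugate_comp, hmk w, h2]
  rw [hP, hQ]
  exact h'

end InfinityType

/-! ### §4. Algebra of base change: products, inverses, the norm character -/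

section Algebra

variable {F : Type} (E : Type) [Field F] [Field E] [Algebra F E] [NumberField F] [NumberField E]
  [IsGalois F E]

/-- `(ω₁ ω₂) ∘ N = (ω₁ ∘ N)(ω₂ ∘ N)`. [cite: CasselsFrohlichANT1967, Ch. VII Prop. 4.3 (`ψ ∘ N`)] -/
theorem HeckeCharacter.compRelNorm_mul (ω₁ ω₂ : HeckeCharacter F) :
    (ω₁ * ω₂).compRelNorm E = ω₁.compRelNorm E * ω₂.compRelNorm E :=
  HeckeCharacter.ext fun y ↦ by
    rw [HeckeCharacter.compRelNorm_apply, HeckeCharacter.mul_apply, HeckeCharacter.mul_apply,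
      HeckeCharacter.compRelNorm_apply, HeckeCharacter.compRelNorm_apply]

/-- `1 ∘ N = 1`. [cite: CasselsFrohlichANT1967, Ch. VII Prop. 4.3 (`ψ ∘ N`)] -/
theorem HeckeCharacter.compRelNorm_one : (1 : HeckeCharacter F).compRelNorm E = 1 :=
  HeckeCharacter.ext fun y ↦ by
    rw [HeckeCharacter.compRelNorm_apply, HeckeCharacter.one_apply, HeckeCharacter.one_apply]

/-- `ω⁻¹ ∘ N = (ω ∘ N)⁻¹`. [cite: CasselsFrohlichANT1967, Ch. VII Prop. 4.3 (`ψ ∘ N`)] -/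
theorem HeckeCharacter.compRelNorm_inv (ω : HeckeCharacter F) :
    ω⁻¹.compRelNorm E = (ω.compRelNorm E)⁻¹ :=
  eq_inv_of_mul_eq_one_left (by rw [← HeckeCharacter.compRelNorm_mul, inv_mul_cancel,
    HeckeCharacter.compRelNorm_one])

/-- **`‖·‖_F ∘ N_{E/F} = ‖·‖_E`: the norm character base-changes to the norm character** (the module
of a norm, `AdelicBaseChange.ideleNorm_ideleRelNorm`: `‖N_{E/F} 𝐀‖_F = ‖𝐀‖_E`, Weil IV §3 / Cassels
II §11, through `automorphic_ideleRelNorm_eq`). With `compRelNorm_mul/_inv` this transports norm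
twists: `(ω · ‖·‖^{-1}) ∘ N = (ω ∘ N) · ‖·‖_E^{-1}` — the shape of the Katz frame's
`λ = (ψ_W ∘ N_{L/K}) · N_L⁻¹`. [cite: WeilBNT1967, Ch. IV §3, Corollary of Proposition 3] [cite: CasselsFrohlichANT1967, Ch. II §11 Theorem] -/
theorem HeckeCharacter.normCharacter_compRelNorm :
    (HeckeCharacter.normCharacter F).compRelNorm E = HeckeCharacter.normCharacter E := by
  refine HeckeCharacter.ext fun y ↦ Units.ext ?_
  rw [HeckeCharacter.compRelNorm_apply, HeckeCharacter.normCharacter_apply,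
    HeckeCharacter.normCharacter_apply, AdelicBaseChange.automorphic_ideleRelNorm_eq,
    AdelicBaseChange.galoisRepresentations_ideleNorm_ideleRelNorm]

end Algebra

end Literature.NumberTheory.GaloisRepresentations

end
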